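import Summits.HodgeConjecture.HodgeConjecture.Theses.EndoscopicMiddleDegree
import Literature.AlgebraicGeometry.Motives.ComplexPointsOrientation
import Literature.AlgebraicTopology.SingularHomology.PoincareDualityProofs

/-!
# Route EndoscopicMiddleDegree — the glue `AlgebraicOrEnvelopedOfSplit` (item stmt-HodgeConjecture-14944)

The support item `AlgebraicOrEnvelopedOfSplit` of route `route-HodgeConjecture-EndoscopicMiddleDegree`
(rev 11) is the implication

`CupProductAlgebraic → OrthogonalSplit → OrthogonalEnveloped → AlgebraicOrEnveloped`,

the rev-7 glue formerly inlined in the deciding theorem, moved out so that `closes` is crux-only.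

The proof.  Fix `m ∈ {1, 2}`, a ball quotient `X` with `D : UnitaryBallQuotientDatum (2(m+1)) X`,
the degree-`2m` hypothesis (every rational Hodge `(m, m)`-class is algebraic) and a rational Hodge
`(m+1, m+1)`-class `c`.  `OrthogonalSplit` puts `c` in the sum of the theta world
`TW(D) = SC^{m+1}(D) ⊔ SCon ⊔ span {a ∪ d}` and of the span of the rational Hodge classes
cup-orthogonal to `TW(D)`.  The three summands of `TW(D)` lie in `algebraicClasses X (m + 1)`:

1. the special cycle classes (`⨆` over totally positive definite `W` of `E`-dimension `m + 1` of
   the classes supported on `c(W)`): `c(W)` is Zariski closed (`D.isClosed_specialSubvariety`) of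
   codimension `≥ m + 1` (`D.le_coheight_of_mem_specialSubvariety`), so
   `classesSupportedOn_le_supportedClasses` applies;
2. the classes supported on closed `Z ⊆ c(W)` (`dim_E W = m`) of codimension `≥ m + 1`
   ("cycles on special cycles"): `classesSupportedOn_le_supportedClasses` verbatim;
3. the Lefschetz summand `span {a ∪ d}` (`a` rational Hodge `(m, m)`, `d ∈ algebraicClasses X 1`):
   `a` is algebraic by the degree-`2m` hypothesis and the product by `CupProductAlgebraic`
   (`X` is smooth projective by `D.isSmoothProjective`).

The orthogonal span is bounded by the enveloped span of `AlgebraicOrEnveloped` through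
`Submodule.span_mono`: each generator `e` (rational, Hodge `(m+1, m+1)`, cup-orthogonal to `TW(D)`)
is enveloped by `OrthogonalEnveloped` at the complex orientation family
`μ₀ h := Classical.choice (Motives.ComplexPoints.isOrientableOver ℂ h)`, which has Poincaré
duality (`OrientationFamily.hasPoincareDuality_of` fed with the tree's theorem `poincare_duality`,
Hatcher Thm. 3.30).  The orientation family is built HERE (Theorems side), which is why the route
file itself imports neither `Motives.ComplexPointsOrientation` nor a Poincaré-duality proof file.
-/

-- `Summit.HodgeConjecture.HodgeConjecture.Theorems` is the mandated namespace (single-problem summit: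
-- Problem = Summit), which `linter.dupNamespace` flags on every declaration; the lakefile turns the
-- linter off tree-wide (weak option), restated here so stand-alone elaboration is warning-free too.
set_option linter.dupNamespace false

namespace Summit.HodgeConjecture.HodgeConjecture.Theorems

open Summit.HodgeConjecture.HodgeConjecture.Theses.EndoscopicMiddleDegree
open Literature.AlgebraicGeometry.HodgeTheory Literature.AlgebraicGeometry.ShimuraVarieties

/-- **The glue `AlgebraicOrEnvelopedOfSplit` of route EndoscopicMiddleDegree** (item
stmt-HodgeConjecture-14944): `CupProductAlgebraic → OrthogonalSplit → OrthogonalEnveloped →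
AlgebraicOrEnveloped`.  Split a rational Hodge `(m+1, m+1)`-class along `OrthogonalSplit`; the theta
world is algebraic (special cycle classes and cycles-on-special-cycles by
`classesSupportedOn_le_supportedClasses` with the datum's closedness / codimension fields, the
Lefschetz summand by the degree-`2m` hypothesis and `CupProductAlgebraic`), and the span of the
theta-orthogonal rational Hodge classes lies in the enveloped span by `Submodule.span_mono`, each
generator being enveloped by `OrthogonalEnveloped` at the complex orientation family (which has
Poincaré duality, Hatcher Thm. 3.30). -/
theorem algebraicOrEnvelopedOfSplit_proof :
    Summit.HodgeConjecture.HodgeConjecture.Theses.EndoscopicMiddleDegree.AlgebraicOrEnvelopedOfSplit := by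
  unfold AlgebraicOrEnvelopedOfSplit
  intro h₉ h₃ h₂ m X D hm1 hm2 hlow c hc hH
  have hX : Literature.AlgebraicGeometry.Motives.IsSmoothProjective (2 * (m + 1)) X :=
    D.isSmoothProjective
  -- the complex orientation family, with Poincaré duality (Hatcher Thm 3.30), for the Gysin maps
  -- `pr₁₊` in `OrthogonalEnveloped` / `AlgebraicOrEnveloped`
  obtain ⟨μ, hμ⟩ : ∃ μ : OrientationFamily, μ.HasPoincareDuality :=
    ⟨fun _ _ h ↦ Classical.choice
        (Literature.AlgebraicGeometry.Motives.ComplexPoints.isOrientableOver ℂ h),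
      OrientationFamily.hasPoincareDuality_of
        (fun ν _ _ h ↦ Literature.AlgebraicTopology.SingularHomology.poincare_duality ν h) _⟩
  refine SetLike.le_def.1 ?_ (h₃ m X D hm1 hm2 c hc hH)
  refine sup_le (le_sup_of_le_left (sup_le (sup_le ?_ ?_) ?_)) (le_sup_of_le_right ?_)
  · -- (1) special cycles of codimension `m + 1` are algebraic
    refine iSup_le fun W ↦ iSup_le fun hW ↦ iSup_le fun hk ↦
      classesSupportedOn_le_supportedClasses (D.isClosed_specialSubvariety W hW) (fun z hz ↦ ?_) _
    have := D.le_coheight_of_mem_specialSubvariety W hW z hz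
    rw [hk] at this
    exact_mod_cast this
  · -- (2) codimension-`(m+1)` cycles on the codimension-`m` special cycles are algebraic
    exact iSup_le fun _ ↦ iSup_le fun _ ↦ iSup_le fun _ ↦ iSup_le fun _ ↦ iSup_le fun hZ ↦
      iSup_le fun _ ↦ iSup_le fun hk ↦ classesSupportedOn_le_supportedClasses hZ hk _
  · -- (3) the Lefschetz / product summand: HC in degree `2m` (hypothesis) and cup products of
    -- algebraic classes (`CupProductAlgebraic`)
    refine Submodule.span_le.2 ?_
    rintro z ⟨a, ha, haH, d, hd, rfl⟩
    exact h₉ hX m 1 a d (hlow a ha haH) hd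
  · -- (4) the theta-orthogonal kernel: each generator is enveloped (`OrthogonalEnveloped` at `μ`)
    refine Submodule.span_mono ?_
    rintro e ⟨he, heH, horth⟩
    obtain ⟨γ, hγ, hrat, hhodge, hfix⟩ := h₂ μ hμ m X D hm1 hm2 e he heH horth
    exact ⟨he, μ, hμ, γ, hγ, hrat, hhodge, hfix⟩

end Summit.HodgeConjecture.HodgeConjecture.Theorems
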